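import Mathlib
import Summits.Ventures.PercRepro2.CoinTwoStar
import Summits.Ventures.PercRepro2.CoinFunctionalDefs
import Summits.Ventures.PercRepro2.CoinFunctionalReduce
import Summits.Ventures.PercRepro2.CoinKStarAbstract
import Summits.Ventures.PercRepro2.CoinKStarTrace
import Summits.Ventures.PercRepro2.CoinKStar

/-!
# Row 2′DARC at EVERY k-STAR pendant head — FUNCTIONAL FORM (blind cell PercRepro2,
night-2 g5; proofs/NIGHT2-DARC.md §26, §22.1′)

THEOREM `darcF_of_kStar_mixed`: `darc_of_kStar_mixed` for a pair of increasing `[0, 1]`-valued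
cluster functionals `F₁, F₂` blind to `P ∪ {t}` (point markers are the special case
`F = 1[a ∈ ·]`).  The same proof: `darcF_of_trace_functional` + the abstract k-star lemma with the
marker masses `G S = P(R_{S ∪ {t}}) − E[F₁; R_{S ∪ {t}}]`, whose cleared ratio monotonicity is the
BHK shift `shiftF`.  The statement of `darc_of_kStar_mixed`: the head `P = {w} ∪ Vs` closed out into the single target `t`,
with arm coins `c v = {w → v}` and leaf coins `d v = {v → t}` for the leaves `v ∈ Vs`
(`v ∈ K⁻ ⟺ d v` open; `w ∈ K⁻ ⟺ ∃ v, c v ∧ d v` open), arbitrary arm and leaf probabilities,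
arbitrary entries from the core; `a, b, u ∉ P ∪ {t}`; the reduced avoidance events
non-degenerate.  Then `DARC p arcs s {t} a b u w`.  This is the first head beyond the reach of the
sign method (the abstract pendant lemma is FALSE for the 3-star, §24.4): the proof is the general
reduction `darc_of_trace_functional` plus the ABSTRACT k-STAR LEMMA `kStar_functional_nonneg`
(avoidance-function form: Holley / FKG comparisons on the leaf lattice and the tilt lemma), whose
inputs are produced here — the avoidance function `F S = P_{D₀}(s ↛ S ∪ {t})` is nonnegative,
decreasing and log-supermodular (`prob_avoid_lsm` = `vdBKC` with `A = B = ∅`), the marker masses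
are differences of avoidance probabilities (`massE_marker_avoid`), and the trace law of the star
is the product `kA` / `kB` (`prob_traceLevel_kStar_notMem` / `_mem`).
-/

namespace Summit.Ventures.PercRepro2.Coin

section KStarF

open Classical

variable {V : Type*} {E : Type*} [Fintype V] [DecidableEq V] [Fintype E] [DecidableEq E]
  {R : Type*} [Field R] [LinearOrder R] [IsStrictOrderedRing R]

/-- **THEOREM (row 2′DARC at every k-star pendant head, mixed coin systems, FUNCTIONAL FORM):**
for increasing `[0, 1]`-valued cluster functionals `F₁, F₂` blind to `P ∪ {t}`. -/
theorem darcF_of_kStar_mixed (p : E → R) (hp : IsProbVec p) {arcs : E → Finset (V × V)}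
    (hS : SameEnds arcs) (s u w t : V) (Vs : Finset V) (hwV : w ∉ Vs)
    (hclosed : ClosedOut arcs (insert w Vs) {t}) (hT : TailCoinsIn arcs (insert w Vs) {t})
    {c d : V → E} (hcd : ∀ v ∈ Vs, ∀ v' ∈ Vs, c v ≠ d v') (hc : Set.InjOn c Vs)
    (hd : Set.InjOn d Vs) (hleaf : ∀ v ∈ Vs, bwdEvent arcs v {t} = openEdge (d v))
    (hhead : bwdEvent arcs w {t} = ⋃ v ∈ Vs, (openEdge (c v) ∩ openEdge (d v)))
    {F₁ F₂ : Set V → R} (hF₁ : Monotone F₁) (hF₂ : Monotone F₂) (hF₁0 : ∀ S, 0 ≤ F₁ S)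
    (hF₂0 : ∀ S, 0 ≤ F₂ S) (hF₁1 : ∀ S, F₁ S ≤ 1) (hF₂1 : ∀ S, F₂ S ≤ 1)
    (hF₁b : ∀ S : Set V, F₁ (S \ ↑(insert w Vs ∪ {t})) = F₁ S)
    (hF₂b : ∀ S : Set V, F₂ (S \ ↑(insert w Vs ∪ {t})) = F₂ S) (hu : u ∉ insert w Vs ∪ {t})
    (hP : ∀ Z ∈ (insert w Vs).powerset,
      0 < prob p (avoidEvent (arcsOff arcs (insert w Vs ∪ {t})) s (Z ∪ {t})))
    (hQ : ∀ Z ∈ (insert w Vs).powerset,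
      0 < prob p (avoidEvent (arcsOff arcs (insert w Vs ∪ {t})) s (gateTarget u w Z {t}))) :
    DARCF p arcs s {t} F₁ F₂ u w := by
  have hwP : w ∈ insert w Vs := Finset.mem_insert_self w Vs
  have hS₀ : SameEnds (arcsOff arcs (insert w Vs ∪ {t})) := sameEnds_arcsOff hS _
  refine darcF_of_trace_functional p hp hS hclosed hT s u w hwP hF₁ hF₂ hF₁0 hF₂0 hF₁b hF₂b hu
    hQ ?_
  -- the avoidance function of the reduced system and the trace data
  set D₀ := arcsOff arcs (insert w Vs ∪ {t}) with hD₀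
  set X₀ : Config E → R := fun ω => F₁ (clusterC D₀ ω s) with hX₀
  set Y₀ : Config E → R := fun ω => F₂ (clusterC D₀ ω s) with hY₀
  set F : Finset V → R := fun S => prob p (avoidEvent D₀ s (S ∪ {t})) with hF
  set ℓ : Finset V → R := fun Z => prob p (traceLevel arcs {t} (insert w Vs) Z) with hℓ
  set Qz : Finset V → R := fun Z => prob p (avoidEvent D₀ s (gateTarget u w Z {t})) with hQz
  set Az : Finset V → R := fun Z => massE p X₀ (avoidEvent D₀ s (Z ∪ {t})) with hAz
  set Bz : Finset V → R := fun Z => massE p Y₀ (avoidEvent D₀ s (Z ∪ {t})) with hBz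
  set Ahz : Finset V → R := fun Z => massE p X₀ (avoidEvent D₀ s (gateTarget u w Z {t})) with hAhz
  set Bhz : Finset V → R := fun Z => massE p Y₀ (avoidEvent D₀ s (gateTarget u w Z {t})) with hBhz
  set β : V → R := fun v => p (d v) with hβ
  set q : V → R := fun v => 1 - p (c v) with hq
  set Ga : Finset V → R := fun S => F S - Az S with hGa
  set Gb : Finset V → R := fun S => F S - Bz S with hGb
  show 0 ≤ ∑ Z ∈ (insert w Vs).powerset, ℓ Z * Qz Z *
      (Ahz Z / Qz Z * (∑ Z' ∈ (insert w Vs).powerset, ℓ Z' * F Z') -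
        ∑ Z' ∈ (insert w Vs).powerset, ℓ Z' * Az Z') *
      (Bhz Z / Qz Z * (∑ Z' ∈ (insert w Vs).powerset, ℓ Z' * F Z') -
        ∑ Z' ∈ (insert w Vs).powerset, ℓ Z' * Bz Z')
  -- membership facts
  have huV : u ∉ Vs := fun h => hu (Finset.mem_union_left _ (Finset.mem_insert_of_mem h))
  have hwu : w ≠ u := fun h => hu (Finset.mem_union_left _ (h ▸ hwP))
  have hwnotin : ∀ L ⊆ Vs, w ∉ L := fun L hL h => hwV (hL h)
  have hLP : ∀ L ⊆ Vs, L ∈ (insert w Vs).powerset := fun L hL =>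
    Finset.mem_powerset.mpr (hL.trans (Finset.subset_insert w Vs))
  have hwLP : ∀ L ⊆ Vs, insert w L ∈ (insert w Vs).powerset := fun L hL =>
    Finset.mem_powerset.mpr (Finset.insert_subset_insert w hL)
  -- the hypotheses of the abstract lemma
  have hF0 : ∀ S, 0 ≤ F S := fun S => prob_nonneg hp _
  have hFdec : ∀ S S', S ⊆ S' → F S' ≤ F S := fun S S' h =>
    prob_mono hp (avoidEvent_anti _ _ (Finset.union_subset_union_left h))
  have hFlsm : ∀ S S', F S * F S' ≤ F (S ∩ S') * F (S ∪ S') := fun S S' => by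
    have h := prob_avoid_lsm p hp hS₀ s (S ∪ {t}) (S' ∪ {t})
    rwa [union_singleton_inter, union_singleton_union] at h
  have hFpos : ∀ L ⊆ Vs, 0 < F L := fun L hL => hP L (hLP L hL)
  have hgate_w : ∀ L : Finset V, gateTarget u w (insert w L) {t} = insert u (insert w L) ∪ {t} := by
    intro L
    rw [gateTarget_of_mem (Finset.mem_insert_self w L)]
    simp only [Finset.insert_union]
  have hFposwu : ∀ L ⊆ Vs, 0 < F (insert u (insert w L)) := fun L hL => by
    have h := hQ (insert w L) (hwLP L hL)
    rwa [hgate_w L] at h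
  have hβ0 : ∀ i ∈ Vs, 0 ≤ β i := fun i _ => hp.nonneg (d i)
  have hβ1 : ∀ i ∈ Vs, β i ≤ 1 := fun i _ => hp.le_one (d i)
  have hq0 : ∀ i ∈ Vs, 0 ≤ q i := fun i _ => by
    show 0 ≤ 1 - p (c i); linarith [hp.le_one (c i)]
  have hq1 : ∀ i ∈ Vs, q i ≤ 1 := fun i _ => by
    show 1 - p (c i) ≤ 1; linarith [hp.nonneg (c i)]
  have hGa0 : ∀ S, 0 ≤ Ga S := fun S => by
    show 0 ≤ prob p (avoidEvent D₀ s (S ∪ {t})) - massE p X₀ (avoidEvent D₀ s (S ∪ {t}))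
    linarith [massE_le_prob_of_le_one p hp (f := X₀) (fun ω => hF₁1 _) (avoidEvent D₀ s (S ∪ {t}))]
  have hGb0 : ∀ S, 0 ≤ Gb S := fun S => by
    show 0 ≤ prob p (avoidEvent D₀ s (S ∪ {t})) - massE p Y₀ (avoidEvent D₀ s (S ∪ {t}))
    linarith [massE_le_prob_of_le_one p hp (f := Y₀) (fun ω => hF₂1 _) (avoidEvent D₀ s (S ∪ {t}))]
  have hGam : ∀ S S', S ⊆ S' → Ga S * F S' ≤ Ga S' * F S := fun S S' h => by
    have hsh := shiftF p hp hS₀ s hF₁ hF₁0 (Finset.union_subset_union_left h : S ∪ {t} ⊆ S' ∪ {t})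
    show (prob p (avoidEvent D₀ s (S ∪ {t})) - massE p X₀ (avoidEvent D₀ s (S ∪ {t}))) *
        prob p (avoidEvent D₀ s (S' ∪ {t})) ≤
      (prob p (avoidEvent D₀ s (S' ∪ {t})) - massE p X₀ (avoidEvent D₀ s (S' ∪ {t}))) *
        prob p (avoidEvent D₀ s (S ∪ {t}))
    nlinarith [hsh]
  have hGbm : ∀ S S', S ⊆ S' → Gb S * F S' ≤ Gb S' * F S := fun S S' h => by
    have hsh := shiftF p hp hS₀ s hF₂ hF₂0 (Finset.union_subset_union_left h : S ∪ {t} ⊆ S' ∪ {t})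
    show (prob p (avoidEvent D₀ s (S ∪ {t})) - massE p Y₀ (avoidEvent D₀ s (S ∪ {t}))) *
        prob p (avoidEvent D₀ s (S' ∪ {t})) ≤
      (prob p (avoidEvent D₀ s (S' ∪ {t})) - massE p Y₀ (avoidEvent D₀ s (S' ∪ {t}))) *
        prob p (avoidEvent D₀ s (S ∪ {t}))
    nlinarith [hsh]
  -- the trace data in terms of `F`, `kA`, `kB`
  have hℓL : ∀ L ⊆ Vs, ℓ L = kA Vs β q L := fun L hL =>
    prob_traceLevel_kStar_notMem p hwV hcd hc hd hleaf hhead hL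
  have hℓw : ∀ L ⊆ Vs, ℓ (insert w L) = kB Vs β q L := fun L hL =>
    prob_traceLevel_kStar_mem p hwV hcd hc hd hleaf hhead hL
  have hQL : ∀ L ⊆ Vs, Qz L = F L := fun L hL => by
    show prob p (avoidEvent D₀ s (gateTarget u w L {t})) = prob p (avoidEvent D₀ s (L ∪ {t}))
    rw [gateTarget_of_notMem (hwnotin L hL)]
  have hQw : ∀ L : Finset V, Qz (insert w L) = F (insert u (insert w L)) := fun L => by
    show prob p (avoidEvent D₀ s (gateTarget u w (insert w L) {t})) = _
    rw [hgate_w L]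
  have hAzF : ∀ Z, Az Z = F Z - Ga Z := fun Z => by
    show Az Z = F Z - (F Z - Az Z); ring
  have hBzF : ∀ Z, Bz Z = F Z - Gb Z := fun Z => by
    show Bz Z = F Z - (F Z - Bz Z); ring
  have hAhzL : ∀ L ⊆ Vs, Ahz L = F L - Ga L := fun L hL => by
    show massE p X₀ (avoidEvent D₀ s (gateTarget u w L {t})) =
      F L - (F L - massE p X₀ (avoidEvent D₀ s (L ∪ {t})))
    rw [gateTarget_of_notMem (hwnotin L hL)]; ring
  have hBhzL : ∀ L ⊆ Vs, Bhz L = F L - Gb L := fun L hL => by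
    show massE p Y₀ (avoidEvent D₀ s (gateTarget u w L {t})) =
      F L - (F L - massE p Y₀ (avoidEvent D₀ s (L ∪ {t})))
    rw [gateTarget_of_notMem (hwnotin L hL)]; ring
  have hAhzw : ∀ L : Finset V,
      Ahz (insert w L) = F (insert u (insert w L)) - Ga (insert u (insert w L)) :=
    fun L => by
      show massE p X₀ (avoidEvent D₀ s (gateTarget u w (insert w L) {t})) =
        F (insert u (insert w L)) -
          (F (insert u (insert w L)) - massE p X₀ (avoidEvent D₀ s (insert u (insert w L) ∪ {t})))
      rw [hgate_w L]; ring
  have hBhzw : ∀ L : Finset V,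
      Bhz (insert w L) = F (insert u (insert w L)) - Gb (insert u (insert w L)) :=
    fun L => by
      show massE p Y₀ (avoidEvent D₀ s (gateTarget u w (insert w L) {t})) =
        F (insert u (insert w L)) -
          (F (insert u (insert w L)) - massE p Y₀ (avoidEvent D₀ s (insert u (insert w L) ∪ {t})))
      rw [hgate_w L]; ring
  -- from here on the marker masses are opaque
  clear_value Ga Gb
  -- splitting the powerset of `insert w Vs`
  have hsplit : ∀ g : Finset V → R, ∑ Z ∈ (insert w Vs).powerset, g Z =
      ∑ L ∈ Vs.powerset, g L + ∑ L ∈ Vs.powerset, g (insert w L) := fun g => by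
    have h := sum_powerset_split (Vs := insert w Vs) (i := w) hwP g
    rwa [Finset.erase_insert hwV] at h
  -- the total mass and the marker masses
  have eΛ : ∑ Z' ∈ (insert w Vs).powerset, ℓ Z' * F Z' = kLam Vs β q w F := by
    rw [hsplit, kLam, ← Finset.sum_add_distrib]
    refine Finset.sum_congr rfl fun L hL => ?_
    rw [hℓL L (Finset.mem_powerset.mp hL), hℓw L (Finset.mem_powerset.mp hL)]
  have eMX : ∑ Z' ∈ (insert w Vs).powerset, ℓ Z' * Az Z' = kLam Vs β q w F - kMass Vs β q w Ga := by
    rw [← eΛ, hsplit, hsplit, kMass, ← Finset.sum_add_distrib, ← Finset.sum_add_distrib,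
      ← Finset.sum_sub_distrib]
    refine Finset.sum_congr rfl fun L hL => ?_
    rw [hAzF, hAzF, hℓL L (Finset.mem_powerset.mp hL), hℓw L (Finset.mem_powerset.mp hL)]
    ring
  have eMY : ∑ Z' ∈ (insert w Vs).powerset, ℓ Z' * Bz Z' = kLam Vs β q w F - kMass Vs β q w Gb := by
    rw [← eΛ, hsplit, hsplit, kMass, ← Finset.sum_add_distrib, ← Finset.sum_add_distrib,
      ← Finset.sum_sub_distrib]
    refine Finset.sum_congr rfl fun L hL => ?_
    rw [hBzF, hBzF, hℓL L (Finset.mem_powerset.mp hL), hℓw L (Finset.mem_powerset.mp hL)]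
    ring
  rw [eΛ, eMX, eMY, hsplit]
  -- the two kinds of traces
  have e₁ : ∑ L ∈ Vs.powerset, ℓ L * Qz L *
      (Ahz L / Qz L * kLam Vs β q w F - (kLam Vs β q w F - kMass Vs β q w Ga)) *
      (Bhz L / Qz L * kLam Vs β q w F - (kLam Vs β q w F - kMass Vs β q w Gb)) =
      ∑ L ∈ Vs.powerset, kA Vs β q L * F L *
        (Ga L / F L * kLam Vs β q w F - kMass Vs β q w Ga) *
        (Gb L / F L * kLam Vs β q w F - kMass Vs β q w Gb) := by
    refine Finset.sum_congr rfl fun L hL => ?_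
    have hL := Finset.mem_powerset.mp hL
    have hne := (hFpos L hL).ne'
    rw [hℓL L hL, hQL L hL, hAhzL L hL, hBhzL L hL, sub_div, div_self hne, sub_div, div_self hne]
    ring
  have e₂ : ∑ L ∈ Vs.powerset, ℓ (insert w L) * Qz (insert w L) *
      (Ahz (insert w L) / Qz (insert w L) * kLam Vs β q w F -
        (kLam Vs β q w F - kMass Vs β q w Ga)) *
      (Bhz (insert w L) / Qz (insert w L) * kLam Vs β q w F -
        (kLam Vs β q w F - kMass Vs β q w Gb)) =
      ∑ L ∈ Vs.powerset, kB Vs β q L * F (insert u (insert w L)) *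
        (Ga (insert u (insert w L)) / F (insert u (insert w L)) * kLam Vs β q w F -
          kMass Vs β q w Ga) *
        (Gb (insert u (insert w L)) / F (insert u (insert w L)) * kLam Vs β q w F -
          kMass Vs β q w Gb) := by
    refine Finset.sum_congr rfl fun L hL => ?_
    have hL := Finset.mem_powerset.mp hL
    have hne := (hFposwu L hL).ne'
    rw [hℓw L hL, hQw L, hAhzw L, hBhzw L, sub_div, div_self hne, sub_div, div_self hne]
    ring
  rw [e₁, e₂]
  exact kStar_functional_nonneg Vs w u hwV huV hwu F Ga Gb hF0 hFdec hFlsm hFpos hFposwu hGa0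
    hGb0 hGam hGbm β q hβ0 hβ1 hq0 hq1

end KStarF

end Summit.Ventures.PercRepro2.Coin
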